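import Literature.NumberTheory.LFunctions.Equivalents
import Literature.NumberTheory.LFunctions.DeBruijnNewmanConstProofs
import Literature.NumberTheory.LFunctions.ZetaRealAxis
import Literature.NumberTheory.LFunctions.RHWave0
import HarnessLib

/-!
# Upper bounds for the de Bruijn–Newman constant: the Polymath 15 criterion and `Λ ≤ 0.2`

Trunk T-ANT (`Literature/NumberTheory/LFunctions`); companion of `Equivalents.lean` for the named
fact `Literature.NumberTheory.LFunctions.platt_trudgian` (`Λ ≤ 0.2`: D. Platt, T. Trudgian, *The Riemann hypothesis is true
up to `3·10¹²`*, Bull. LMS 53 (2021), **Cor. 2**), in the normalisation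
`H_t(z) = ∫₀^∞ e^{tu²} Φ(u) cos(zu) du` of `DeBruijnNewman.lean` (= Polymath 15, eq. (4);
Rodgers–Tao 2020, eq. (1)).

## The printed proof of `Λ ≤ 0.2` and its decomposition

Platt–Trudgian 2021, §3.4: "The second row in Table 1 on page 65 of [Poly] shows [the `X` in
Table 1 corresponds to `2H`] that one may take `Λ ≤ 0.2` provided one has shown `H > 2.51·10¹²`.
This leads to the following. **Corollary 2.** We have `Λ ≤ 0.2`." So Cor. 2 is the conjunction of
three inputs and a two-line glue:

* **F1** (Platt–Trudgian 2021, Thm. 1; certified computation): RH holds up to height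
  `H = 3 000 175 332 800` — the tree's named fact `Literature.NumberTheory.LFunctions.platt_trudgian_numerical_rh`
  (`RHWave0.lean`).
* **F2** (Polymath 15, Res. Math. Sci. 6 (2019), **Thm. 1.2**, "upper bound criterion"; an analytic
  theorem): if `t₀, X > 0`, `0 < y₀ ≤ 1` satisfy (i) no zeros `ζ(σ + iT) = 0` with
  `(1 + y₀)/2 ≤ σ ≤ 1`, `0 ≤ T ≤ X/2`; (ii) no zeros `H_{t₀}(x + iy) = 0` with `x ≥ X + √(1 − y₀²)`,
  `y₀ ≤ y ≤ √(1 − 2t₀)`; (iii) no zeros `H_t(x + iy) = 0` with `X ≤ x ≤ X + √(1 − y₀²)`,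
  `√(y₀² + 2(t₀ − t)) ≤ y ≤ √(1 − 2t)`, `0 ≤ t ≤ t₀`; then `Λ ≤ t₀ + y₀²/2`. Vendored as the named
  fact `Literature.NumberTheory.LFunctions.Polymath15.upper_bound_criterion`, with the three hypotheses as the definitions
  `Literature.NumberTheory.LFunctions.Polymath15.InitialZeroFree`, `FinalZeroFree`, `BarrierZeroFree`. Its printed proof (§3):
  Prop. 3.1 (dynamics of a single zero: implicit function theorem, Hadamard factorisation, Hermite
  expansion at a repeated zero), Thm. 3.2 (de Bruijn 1950, Thm. 13; **proved** here as
  `Literature.NumberTheory.LFunctions.de_bruijn_strip_shrinking_holds` from the tree's `Literature.Analysis.Complex.DeBruijn1950.rootsInStrip_gaussian`)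
  and Prop. 3.3 (the barrier/continuity argument).
* **F3** (Polymath 15, §10, Table 1 "Conditional `Λ` Results", row 2; certified computation):
  hypotheses (ii) and (iii) hold for `X = 5·10¹² + 194858`, `t₀ = 0.186`, `y₀ = 0.16733`
  (`t₀ + y₀²/2 = 0.19999966…`). Vendored as the named fact `Literature.NumberTheory.LFunctions.Polymath15.table1_row2`.
* Glue (PROVED, `Literature.NumberTheory.LFunctions.platt_trudgian_of_polymath15`): F1 gives (i) because
  `X/2 = 2.5·10¹² + 97429 ≤ H` and `ζ` has no real zeros in `[ (1 + y₀)/2, 1 ]`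
  (`Literature.NumberTheory.LFunctions.Polymath15.initialZeroFree_of_numerical_rh`, from `ZetaRealAxis.lean` and Mathlib's
  `riemannZeta_ne_zero_of_one_le_re`); F2 then gives `H_t` real-rooted for `t > 0.19999966…`,
  in particular for `t > 1/5`, which is `Literature.NumberTheory.LFunctions.platt_trudgian`.

F1 and F3 are computer verifications (F1: the lowest `12 363 153 437 138` zeros; F3: a mesh
evaluation of a Riemann–Siegel type approximation to `20` digits along a barrier at `x ≈ 5·10¹²`),
so `platt_trudgian` remains a named fact; this file makes its exact inputs explicit. F2 is reduced
here, as in print (p. 10), to Polymath 15, **Prop. 3.3**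
(`Literature.NumberTheory.LFunctions.Polymath15.zero_free_region_criterion`, named fact) by
`Literature.NumberTheory.LFunctions.Polymath15.upper_bound_criterion_of_zero_free_region_criterion` (PROVED, from
`de_bruijn_strip_shrinking_holds` and the dictionary `H_0(x + iy) = 0 ⟹ ζ((1 + y)/2 + ix/2) = 0`,
`riemannZeta_eq_zero_of_deBruijnH_zero_eq_zero`), and **Prop. 3.3 — hence F2 — is PROVED** in the
companion file `DeBruijnNewmanUpperBoundProofs.lean` (`Polymath15.zero_free_region_criterion_holds`,
`Polymath15.upper_bound_criterion_holds`; there `RH.platt_trudgian_of_numerics` derives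
`platt_trudgian` from F1 and F3 alone).

## Also recorded

* `Literature.NumberTheory.LFunctions.Polymath15.new_upper_bound`: Polymath 15, Thm. 1.1, `Λ ≤ 0.22` (named fact; it follows from
  `platt_trudgian`, `Literature.NumberTheory.LFunctions.Polymath15.new_upper_bound_of_platt_trudgian`).
* `Literature.NumberTheory.LFunctions.de_bruijn_strip_shrinking` / `de_bruijn_strip_shrinking_holds` (**proved**): de Bruijn's
  Theorem 13 in the one-sided, shrinking-strip form printed as Polymath 15, Thm. 3.2 ("no zeros of
  `H_{t₀}` with `y > y₀` ⟹ for `t > t₀` no zeros of `H_t` with `y > max(y₀² − 2(t − t₀), 0)^{1/2}`;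
  in particular `Λ ≤ t₀ + y₀²/2`": `hasOnlyRealZeros_deBruijnH_of_im_le`). This is only a
  repackaging of results already in the tree: de Bruijn's Thm. 13 for trigonometric integrals is
  `Literature.Analysis.Complex.DeBruijn1950.rootsInStrip_gaussian` (`Literature/Analysis/Complex/DeBruijnStripShift.lean`)
  and the two-sided endpoint form `Literature.NumberTheory.LFunctions.de_bruijn_strip` is already discharged
  (`Literature.NumberTheory.LFunctions.de_bruijn_strip_holds`, `DeBruijnNewmanConstProofs.lean`, whose glue —
  `2H_t = ∫ F_t e^{izs}`, `F_t e^{λ²s²/2} = F_{t+λ²/2}` — is reused verbatim); the passage from the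
  one-sided hypothesis to de Bruijn's two-sided strip is the conjugation symmetry
  `Literature.NumberTheory.LFunctions.deBruijnH_conj` (proved here).

All statements about `Λ` are `sInf`-free (`∀ t > c, HasOnlyRealZeros (deBruijnH t)` for `Λ ≤ c`),
as in `DeBruijnNewman.lean`/`Equivalents.lean`; convert with `Literature.NumberTheory.LFunctions.deBruijnNewmanConst_le_iff_holds`
(`RH.deBruijnNewmanConst_le_of_polymath15`).

## References

* D. J. Platt, T. S. Trudgian, *The Riemann hypothesis is true up to `3·10¹²`*, Bull. Lond. Math.
  Soc. 53 (2021) 792–797, Thm. 1, §3.4, Cor. 2 (arXiv:2004.09765).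
* D. H. J. Polymath, *Effective approximation of heat flow evolution of the Riemann `ξ` function,
  and a new upper bound for the de Bruijn–Newman constant*, Res. Math. Sci. 6 (2019), Paper 31
  (arXiv:1904.12438): Thms. 1.1, 1.2; §3 (Prop. 3.1, Thm. 3.2, Prop. 3.3); §10, Table 1.
* N. G. de Bruijn, *The roots of trigonometric integrals*, Duke Math. J. 17 (1950) 197–226, Thm. 13.
* E. C. Titchmarsh, *The Theory of the Riemann Zeta-Function*, 2nd ed. (1986), §2.12.
-/

noncomputable section

open Complex MeasureTheory

namespace Literature.NumberTheory.LFunctions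

/-! ## Conjugation symmetry of `H_t` -/

/-- `H_t(z̄) = conj (H_t(z))`: the functional equation `H_t = H_t^*` (Polymath 15, §1: "each of
the `H_t` are entire even functions with functional equation `H_t(z̄) = \overline{H_t(z)}`"),
immediate from the integral `H_t(z) = ∫₀^∞ e^{tu²} Φ(u) cos(zu) du` with real `e^{tu²} Φ(u)`.
[cite: Polymath2019, §1] -/
theorem deBruijnH_conj (t : ℝ) (z : ℂ) :
    deBruijnH t (starRingEnd ℂ z) = starRingEnd ℂ (deBruijnH t z) := by
  rw [deBruijnH, deBruijnH, ← integral_conj]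
  refine integral_congr_ae (Filter.Eventually.of_forall fun u ↦ ?_)
  simp only [map_mul, Complex.conj_ofReal, ← Complex.cos_conj]

/-- The zero set of `H_t` is invariant under complex conjugation. [cite: Polymath2019, §1] -/
theorem deBruijnH_conj_eq_zero {t : ℝ} {z : ℂ} (hz : deBruijnH t z = 0) :
    deBruijnH t (starRingEnd ℂ z) = 0 := by
  rw [deBruijnH_conj, hz, map_zero]

/-! ## de Bruijn's bound (Theorem 13) in the one-sided shrinking-strip form (proved) -/

/-- de Bruijn 1950, Thm. 13, in the one-sided shrinking-strip form printed as Polymath 15,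
Thm. 3.2 (the statement; proved below as `de_bruijn_strip_shrinking_holds`). Suppose `t₀ ∈ ℝ` and
`y₀ > 0` are such that there are no zeros `H_{t₀}(x + iy) = 0` with `x ∈ ℝ` and `y > y₀`. Then for
any `t > t₀` there are no zeros `H_t(x + iy) = 0` with `x ∈ ℝ` and
`y > max(y₀² − 2(t − t₀), 0)^{1/2}`. ("In particular one has `Λ ≤ t₀ + y₀²/2`":
`hasOnlyRealZeros_deBruijnH_of_im_le`.)
[cite: Polymath2019, Thm. 3.2] [cite: Bruijn1950, Thm. 13] -/
def de_bruijn_strip_shrinking : Prop :=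
  ∀ t₀ y₀ : ℝ, 0 < y₀ → (∀ z : ℂ, deBruijnH t₀ z = 0 → z.im ≤ y₀) →
    ∀ t : ℝ, t₀ < t → ∀ z : ℂ, deBruijnH t z = 0 →
      z.im ≤ Real.sqrt (max (y₀ ^ 2 - 2 * (t - t₀)) 0)

/-- A one-sided bound `Im z ≤ y₀` on the zeros of `H_t` is a two-sided one, `|Im z| ≤ y₀`
(de Bruijn's `RootsInStrip`), by the conjugation symmetry of the zero set.
[cite: Polymath2019, §3] -/
theorem rootsInStrip_deBruijnH_of_im_le {t y₀ : ℝ} (hup : ∀ z : ℂ, deBruijnH t z = 0 → z.im ≤ y₀) :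
    Literature.Analysis.Complex.RootsInStrip (deBruijnH t) y₀ := by
  intro z hz
  have h1 := hup z hz
  have h2 := hup _ (deBruijnH_conj_eq_zero hz)
  rw [Complex.conj_im] at h2
  exact abs_le.2 ⟨by linarith, h1⟩

/-- **Proof of `de_bruijn_strip_shrinking` (de Bruijn 1950, Thm. 13 = Polymath 15, Thm. 3.2).**
Exactly the argument of `Literature.NumberTheory.LFunctions.de_bruijn_strip_holds` (`DeBruijnNewmanConstProofs.lean`) with a
general shift: `2H_{t₀} = ∫ F_{t₀} e^{izs} ds` (`trigIntegral_deBruijnKernel`) with `F_{t₀}`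
admissible (`isAdmissible_deBruijnKernel`) and roots in `|Im z| ≤ y₀`
(`rootsInStrip_deBruijnH_of_im_le`); for `t > t₀` put `λ = √(2(t − t₀))`, so that
`F_{t₀}(s) e^{λ²s²/2} = F_t(s)` (`deBruijnKernel_mul_gaussian`) and de Bruijn's Thm. 13
(`Literature.Analysis.Complex.DeBruijn1950.rootsInStrip_gaussian`; `H_t ≢ 0` by `exists_deBruijnH_ne_zero`) puts the
roots of `H_t` in `|Im z| ≤ √max(y₀² − λ², 0) = √max(y₀² − 2(t − t₀), 0)`.
[cite: Bruijn1950, Thm. 13] [cite: Polymath2019, Thm. 3.2] -/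
theorem de_bruijn_strip_shrinking_holds : de_bruijn_strip_shrinking := by
  intro t₀ y₀ hy₀ hup t ht z hz
  set lam : ℝ := Real.sqrt (2 * (t - t₀)) with hlam
  have hlam2 : lam ^ 2 = 2 * (t - t₀) := Real.sq_sqrt (by linarith)
  have hteq : t₀ + lam ^ 2 / 2 = t := by rw [hlam2]; ring
  have hroots : Literature.Analysis.Complex.RootsInStrip (Literature.Analysis.Complex.trigIntegral (deBruijnKernel t₀)) y₀ := by
    intro w hw
    rw [trigIntegral_deBruijnKernel] at hw
    exact rootsInStrip_deBruijnH_of_im_le hup w ((mul_eq_zero.1 hw).resolve_left two_ne_zero)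
  have hne : ∃ w, Literature.Analysis.Complex.trigIntegral
      (fun s ↦ deBruijnKernel t₀ s * ((Real.exp (lam ^ 2 * s ^ 2 / 2) : ℝ) : ℂ)) w ≠ 0 := by
    obtain ⟨w, hw⟩ := exists_deBruijnH_ne_zero t
    refine ⟨w, ?_⟩
    rw [deBruijnKernel_mul_gaussian, hteq, trigIntegral_deBruijnKernel]
    exact mul_ne_zero two_ne_zero hw
  have h :=
    Literature.Analysis.Complex.DeBruijn1950.rootsInStrip_gaussian (isAdmissible_deBruijnKernel t₀) hy₀.le lam hroots hne
  rw [deBruijnKernel_mul_gaussian, hteq, hlam2] at h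
  exact (le_abs_self _).trans (h z (by rw [trigIntegral_deBruijnKernel, hz, mul_zero]))

/-- "In particular `Λ ≤ t₀ + y₀²/2`" (Polymath 15, Thm. 3.2), `sInf`-free and including the
endpoint: if no zero of `H_{t₀}` has imaginary part `> y₀ > 0`, then `H_t` has only real zeros
for every `t ≥ t₀ + y₀²/2`. Immediate from the tree's two-sided endpoint form
`Literature.NumberTheory.LFunctions.de_bruijn_strip_holds` (`Δ = y₀`) and `rootsInStrip_deBruijnH_of_im_le`.
[cite: Polymath2019, Thm. 3.2] -/
theorem hasOnlyRealZeros_deBruijnH_of_im_le {t₀ y₀ : ℝ} (hy₀ : 0 < y₀)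
    (hup : ∀ z : ℂ, deBruijnH t₀ z = 0 → z.im ≤ y₀) {t : ℝ} (ht : t₀ + y₀ ^ 2 / 2 ≤ t) :
    HasOnlyRealZeros (deBruijnH t) :=
  de_bruijn_strip_holds t₀ y₀ hy₀.le (rootsInStrip_deBruijnH_of_im_le hup) t ht

/-! ## Polymath 15, Theorem 1.2: the upper bound criterion -/

namespace Polymath15

/-- Hypothesis (i) of Polymath 15, Thm. 1.2 ("numerical verification of RH at initial time `0`"):
there are no zeros `ζ(σ + iT) = 0` with `(1 + y₀)/2 ≤ σ ≤ 1` and `0 ≤ T ≤ X/2`.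
[cite: Polymath2019, Thm. 1.2 (i)] -/
def InitialZeroFree (X y₀ : ℝ) : Prop :=
  ∀ σ T : ℝ, (1 + y₀) / 2 ≤ σ → σ ≤ 1 → 0 ≤ T → T ≤ X / 2 → riemannZeta (σ + T * I) ≠ 0

/-- Hypothesis (ii) of Polymath 15, Thm. 1.2 ("asymptotic zero-free region at final time `t₀`"):
there are no zeros `H_{t₀}(x + iy) = 0` with `x ≥ X + √(1 − y₀²)` and `y₀ ≤ y ≤ √(1 − 2t₀)`.
[cite: Polymath2019, Thm. 1.2 (ii)] -/
def FinalZeroFree (t₀ X y₀ : ℝ) : Prop :=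
  ∀ x y : ℝ, X + Real.sqrt (1 - y₀ ^ 2) ≤ x → y₀ ≤ y → y ≤ Real.sqrt (1 - 2 * t₀) →
    deBruijnH t₀ (x + y * I) ≠ 0

/-- Hypothesis (iii) of Polymath 15, Thm. 1.2 ("barrier at intermediate times"): there are no
zeros `H_t(x + iy) = 0` with `X ≤ x ≤ X + √(1 − y₀²)`, `√(y₀² + 2(t₀ − t)) ≤ y ≤ √(1 − 2t)` and
`0 ≤ t ≤ t₀`. [cite: Polymath2019, Thm. 1.2 (iii)] -/
def BarrierZeroFree (t₀ X y₀ : ℝ) : Prop :=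
  ∀ t x y : ℝ, 0 ≤ t → t ≤ t₀ → X ≤ x → x ≤ X + Real.sqrt (1 - y₀ ^ 2) →
    Real.sqrt (y₀ ^ 2 + 2 * (t₀ - t)) ≤ y → y ≤ Real.sqrt (1 - 2 * t) →
      deBruijnH t (x + y * I) ≠ 0

/-- NAMED FACT (Polymath 15, Res. Math. Sci. 6 (2019), **Thm. 1.2**, "upper bound criterion").
Suppose that `t₀, X > 0` and `0 < y₀ ≤ 1` obey (i) `InitialZeroFree X y₀`, (ii)
`FinalZeroFree t₀ X y₀` and (iii) `BarrierZeroFree t₀ X y₀`. Then `Λ ≤ t₀ + y₀²/2`, stated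
`sInf`-free as: `H_t` has only real zeros for every `t > t₀ + y₀²/2` (equivalent to
`deBruijnNewmanConst ≤ t₀ + y₀²/2` by `Literature.NumberTheory.LFunctions.deBruijnNewmanConst_le_iff_holds`). Printed proof (§3):
Prop. 3.1 (zero dynamics), Thm. 3.2 (`de_bruijn_strip_shrinking_holds`), Prop. 3.3 (barrier
argument; named fact `zero_free_region_criterion` below, from which this fact follows:
`upper_bound_criterion_of_zero_free_region_criterion`). Discharged:
`Polymath15.upper_bound_criterion_holds` (`DeBruijnNewmanUpperBoundProofs.lean`).
[cite: Polymath2019, Thm. 1.2] -/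
def upper_bound_criterion : Prop :=
  ∀ t₀ X y₀ : ℝ, 0 < t₀ → 0 < X → 0 < y₀ → y₀ ≤ 1 →
    InitialZeroFree X y₀ → FinalZeroFree t₀ X y₀ → BarrierZeroFree t₀ X y₀ →
      ∀ t : ℝ, t₀ + y₀ ^ 2 / 2 < t → HasOnlyRealZeros (deBruijnH t)

/-- NAMED FACT (Polymath 15, **Thm. 1.1**, "new upper bound"): `Λ ≤ 0.22`, `sInf`-free: `H_t` has
only real zeros for every `t > 0.22`. (Obtained in print from Thm. 1.2 with `t₀ = 0.2`,
`X = 6·10¹⁰ + 83952 − 0.5`, `y₀ = 0.2` and Platt's RH verification to height `3.06·10¹⁰`;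
superseded by `Literature.NumberTheory.LFunctions.platt_trudgian`, see `new_upper_bound_of_platt_trudgian`.)
[cite: Polymath2019, Thm. 1.1] -/
def new_upper_bound : Prop :=
  ∀ t : ℝ, 0.22 < t → HasOnlyRealZeros (deBruijnH t)

/-- NAMED FACT (computational claim; Polymath 15, §10, Table 1 "Conditional `Λ` Results", second
row: `X = 5·10¹² + 194858`, `t₀ = 0.186`, `y₀ = 0.16733`, `Λ = 0.20`, winding number `0`,
`N₀ = 630783`, `|f_t(x + iy)|` lower bound `0.0376`). Hypotheses (ii) and (iii) of Thm. 1.2 hold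
for these parameters: "The table below collects some numerical results verifying the second two
hypotheses of Theorem 1.2 for larger values of `X`, and smaller values of `t₀, y₀`". Evidence as
printed: the barrier (iii) was run (in the larger region `X ≤ x ≤ X + 1`, `y₀ ≤ y ≤ 1`,
`0 ≤ t ≤ t₀`) with winding number `0` at every rectangle, mesh values to `20` digits; for (ii) the
table reports the lower bound `|f_{t₀}(x + iy₀)| ≥ 0.0376` at `N = N₀`, and §10 says of its
extension to all `N ≥ N₀` by the method of §8 that the authors "expect to be able to verify the
hypothesis". This row (with `t₀ + y₀²/2 = 0.19999966…` and `X/2 = 2.5·10¹² + 97429`) is the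
input of Platt–Trudgian 2021, §3.4/Cor. 2. Users take `(h : table1_row2)`.
[cite: Polymath2019, §10, Table 1 (row 2)] [cite: PlattTrudgianBLMS2021, §3.4] -/
def table1_row2 : Prop :=
  FinalZeroFree 0.186 (5 * 10 ^ 12 + 194858) 0.16733 ∧
    BarrierZeroFree 0.186 (5 * 10 ^ 12 + 194858) 0.16733

/-- Hypothesis (i) of Thm. 1.2 from a numerical verification of RH up to height `H ≥ X/2`
(every zero `s` of `ζ` with `0 < Im s ≤ H` has `Re s = 1/2`): for `T > 0` such a zero would have
`Re s = 1/2 < (1 + y₀)/2`; for `T = 0`, `ζ` has no real zeros in `(0, 1)`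
(`Literature.NumberTheory.LFunctions.riemannZeta_ne_zero_of_im_eq_zero_of_pos_of_lt_one`, Titchmarsh §2.12) and `ζ(1) ≠ 0`
in Mathlib's convention (`riemannZeta_ne_zero_of_one_le_re`). [cite: Titchmarsh1986, §2.12] -/
theorem initialZeroFree_of_numerical_rh {X y₀ H : ℝ} (hy₀ : 0 < y₀) (hX : X / 2 ≤ H)
    (hRH : ∀ s : ℂ, riemannZeta s = 0 → 0 < s.im → s.im ≤ H → s.re = 1 / 2) :
    InitialZeroFree X y₀ := by
  intro σ T hσ hσ1 hT hTX hzero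
  have hre : (σ + T * I : ℂ).re = σ := by simp
  have him : (σ + T * I : ℂ).im = T := by simp
  rcases hT.eq_or_lt with rfl | hTpos
  · rcases hσ1.eq_or_lt with rfl | hσ1'
    · exact riemannZeta_ne_zero_of_one_le_re (by rw [hre]) hzero
    · exact LFunctions.riemannZeta_ne_zero_of_im_eq_zero_of_pos_of_lt_one him (by rw [hre]; linarith)
        (by rw [hre]; exact hσ1') hzero
  · have := hRH _ hzero (by rw [him]; exact hTpos) (by rw [him]; linarith)
    rw [hre] at this
    linarith

/-- Hypothesis (i) of Thm. 1.2 for every `X ≤ 6 000 350 665 600` and `y₀ > 0`, from Platt–Trudgian's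
RH verification to height `3 000 175 332 800` (`Literature.NumberTheory.LFunctions.platt_trudgian_numerical_rh`).
[cite: PlattTrudgianBLMS2021, Thm. 1] -/
theorem initialZeroFree_of_platt_trudgian_numerical_rh (h₁ : LFunctions.platt_trudgian_numerical_rh)
    {X y₀ : ℝ} (hy₀ : 0 < y₀) (hX : X / 2 ≤ 3000175332800) : InitialZeroFree X y₀ :=
  initialZeroFree_of_numerical_rh hy₀ hX fun s hs h0 hT ↦ h₁ s hs h0 hT

/-- `Λ ≤ 0.2` implies `Λ ≤ 0.22`: Polymath 15's Thm. 1.1 from Platt–Trudgian's Cor. 2.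
[cite: PlattTrudgianBLMS2021, Cor. 2] -/
theorem new_upper_bound_of_platt_trudgian (h : LFunctions.platt_trudgian) : new_upper_bound :=
  fun t ht ↦ h t (lt_trans (by norm_num) ht)

end Polymath15

/-! ## Polymath 15, Proposition 3.3, and Theorem 1.2 from it -/

namespace Polymath15

/-- Hypothesis (i) of Polymath 15, Prop. 3.3: there are no zeros `H_0(x + iy) = 0` with
`0 ≤ x ≤ X` and `√(y₀² + 2t₀) ≤ y ≤ 1`. [cite: Polymath2019, Prop. 3.3 (i)] -/
def InitialZeroFreeH (t₀ X y₀ : ℝ) : Prop :=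
  ∀ x y : ℝ, 0 ≤ x → x ≤ X → Real.sqrt (y₀ ^ 2 + 2 * t₀) ≤ y → y ≤ 1 →
    deBruijnH 0 (x + y * I) ≠ 0

/-- NAMED FACT (Polymath 15, **Prop. 3.3**, "zero-free region criterion"). Suppose that
`t₀, X > 0` and `0 < y₀ ≤ 1` obey (i) `InitialZeroFreeH t₀ X y₀` (no zeros `H_0(x + iy) = 0` with
`0 ≤ x ≤ X`, `√(y₀² + 2t₀) ≤ y ≤ 1`), (ii) `FinalZeroFree t₀ X y₀` and (iii)
`BarrierZeroFree t₀ X y₀` (as in Thm. 1.2). Then there are no zeros `H_{t₀}(x + iy) = 0` with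
`x ∈ ℝ` and `y ≥ y₀`. Printed proof (pp. 9–10): remove the caps `y ≤ 1`, `y ≤ √(1 − 2t₀)`,
`y ≤ √(1 − 2t)` by Thm. 3.2 (`de_bruijn_strip_shrinking_holds`) and the critical strip; take the
minimal time `t₁ ∈ (0, t₀]` at which a zero `x + iy`, `0 ≤ x ≤ X`, `y ≥ Y(t) = √(y₀² + 2(t₀ − t))`
appears (continuity of `H_t` in `t`, Rouché); it lies on `y = Y(t₁)`, `0 < x < X` (by (iii) and
`H_t(iy) > 0`); a repeated zero is excluded by Prop. 3.1 (ii) (Hermite splitting), a simple one by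
Prop. 3.1 (i) (the velocity `2 ∑' 1/(z_j − z_k)` from the Hadamard product) and the computation
`Im ż_j(t₁) < Ẏ(t₁) = −1/Y(t₁)` using (iii) and `y_k < 1`. Discharged:
`Polymath15.zero_free_region_criterion_holds` (`DeBruijnNewmanUpperBoundProofs.lean`; the
simple/repeated case split of Prop. 3.1 is replaced there by a uniform multiplicity-`m` argument on
the weighted sum of the zeros in a small rectangle). [cite: Polymath2019, Prop. 3.3] -/
def zero_free_region_criterion : Prop :=
  ∀ t₀ X y₀ : ℝ, 0 < t₀ → 0 < X → 0 < y₀ → y₀ ≤ 1 →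
    InitialZeroFreeH t₀ X y₀ → FinalZeroFree t₀ X y₀ → BarrierZeroFree t₀ X y₀ →
      ∀ x y : ℝ, y₀ ≤ y → deBruijnH t₀ (x + y * I) ≠ 0

/-- Zeros of `H_0` are nontrivial zeros of `ζ` (Polymath 15, (hoz)/(sas):
`H_0(z) = ξ((1 + iz)/2)/8`): if `H_0(x + iy) = 0` then `ζ((1 + y)/2 + ix/2) = 0` and
`(1 + y)/2 < 1`. From `Literature.NumberTheory.LFunctions.deBruijnH_zero_eq_holds` applied to the conjugate zero `x − iy`
(`deBruijnH_conj_eq_zero`) and `Literature.NumberTheory.LFunctions.riemannXi_eq_zero_iff_holds` (zeros of `ξ` = zeros of `ζ` in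
`0 < Re s < 1`).
[cite: Polymath2019, §3 (proof of Thm. 1.2)] -/
theorem riemannZeta_eq_zero_of_deBruijnH_zero_eq_zero {x y : ℝ} (h : deBruijnH 0 (x + y * I) = 0) :
    riemannZeta ((((1 + y) / 2 : ℝ) : ℂ) + ((x / 2 : ℝ) : ℂ) * I) = 0 ∧ (1 + y) / 2 < 1 := by
  have hc := deBruijnH_conj_eq_zero h
  rw [deBruijnH_zero_eq_holds, div_eq_zero_iff] at hc
  have hxi := hc.resolve_right (by norm_num)
  have hconj : (starRingEnd ℂ) ((x : ℂ) + (y : ℂ) * I) = x - y * I := by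
    simp only [map_add, map_mul, Complex.conj_ofReal, Complex.conj_I]
    ring
  have hs : (1 / 2 + I * (starRingEnd ℂ) ((x : ℂ) + (y : ℂ) * I) / 2 : ℂ) =
      (((1 + y) / 2 : ℝ) : ℂ) + ((x / 2 : ℝ) : ℂ) * I := by
    rw [hconj]
    push_cast
    linear_combination (-(y : ℂ) / 2) * Complex.I_mul_I
  rw [hs] at hxi
  obtain ⟨hζ, -, h1⟩ := (riemannXi_eq_zero_iff_holds _).1 hxi
  refine ⟨hζ, ?_⟩
  have hre : ((((1 + y) / 2 : ℝ) : ℂ) + ((x / 2 : ℝ) : ℂ) * I).re = (1 + y) / 2 := by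
    simp [Complex.add_re]
  rwa [hre] at h1

/-- Hypothesis (i) of Thm. 1.2 implies hypothesis (i) of Prop. 3.3 ("noting from (hoz), (sas) that
condition (i) of Proposition 3.3 is implied by condition (i) of Theorem 1.2", p. 10): a zero
`H_0(x + iy) = 0` with `0 ≤ x ≤ X` and `y ≥ y₀` would give the zero `ζ((1 + y)/2 + ix/2) = 0`
with `(1 + y₀)/2 ≤ (1 + y)/2 ≤ 1` and `0 ≤ x/2 ≤ X/2`.
[cite: Polymath2019, §3 (proof of Thm. 1.2)] -/
theorem initialZeroFreeH_of_initialZeroFree {t₀ X y₀ : ℝ} (hy₀ : 0 < y₀) (ht₀ : 0 ≤ t₀)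
    (h : InitialZeroFree X y₀) : InitialZeroFreeH t₀ X y₀ := by
  intro x y hx hxX hy _ hzero
  have hy₀y : y₀ ≤ y := by
    refine le_trans ?_ hy
    calc y₀ = Real.sqrt (y₀ ^ 2) := (Real.sqrt_sq hy₀.le).symm
      _ ≤ Real.sqrt (y₀ ^ 2 + 2 * t₀) := Real.sqrt_le_sqrt (by nlinarith)
  obtain ⟨hζ, h1⟩ := riemannZeta_eq_zero_of_deBruijnH_zero_eq_zero hzero
  exact h ((1 + y) / 2) (x / 2) (by linarith) h1.le (by linarith) (by linarith) hζ

/-- **Polymath 15, Thm. 1.2 from Prop. 3.3** (the printed proof, p. 10: "By combining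
Proposition 3.3 with Theorem 3.2, we obtain Theorem 1.2, noting from (hoz), (sas) that condition (i)
of Proposition 3.3 is implied by condition (i) of Theorem 1.2"): Prop. 3.3 leaves no zero of
`H_{t₀}` with imaginary part `≥ y₀`, and de Bruijn's Thm. 13 (`hasOnlyRealZeros_deBruijnH_of_im_le`)
then makes `H_t` real-rooted for `t ≥ t₀ + y₀²/2`. [cite: Polymath2019, Thm. 1.2] -/
theorem upper_bound_criterion_of_zero_free_region_criterion (h : zero_free_region_criterion) :
    upper_bound_criterion := by
  intro t₀ X y₀ ht₀ hX hy₀ hy₁ h₁ h₂ h₃ t ht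
  have hP := h t₀ X y₀ ht₀ hX hy₀ hy₁ (initialZeroFreeH_of_initialZeroFree hy₀ ht₀.le h₁) h₂ h₃
  have hup : ∀ z : ℂ, deBruijnH t₀ z = 0 → z.im ≤ y₀ := fun z hz ↦ by
    by_contra hlt
    have := hP z.re z.im (not_le.1 hlt).le
    rw [Complex.re_add_im] at this
    exact this hz
  exact hasOnlyRealZeros_deBruijnH_of_im_le hy₀ hup ht.le

end Polymath15

/-! ## Platt–Trudgian 2021, Corollary 2: `Λ ≤ 0.2` from its three inputs -/

section RH

/-- **Platt–Trudgian 2021, Cor. 2 (`Λ ≤ 0.2`), assembled exactly as printed (§3.4)** from: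
F1 = Thm. 1 (`platt_trudgian_numerical_rh`, RH to height `3 000 175 332 800`), F2 = Polymath 15
Thm. 1.2 (`Polymath15.upper_bound_criterion`) and F3 = Polymath 15 §10 Table 1 row 2
(`Polymath15.table1_row2`, `X = 5·10¹² + 194858`, `t₀ = 0.186`, `y₀ = 0.16733`): hypothesis (i)
holds since `X/2 = 2.5·10¹² + 97429 ≤ 3 000 175 332 800`
(`Polymath15.initialZeroFree_of_platt_trudgian_numerical_rh`), so `H_t` has only real zeros for
`t > 0.186 + 0.16733²/2 = 0.19999966…`, in particular for `t > 1/5`.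
[cite: PlattTrudgianBLMS2021, §3.4 and Cor. 2] -/
theorem platt_trudgian_of_polymath15 (h₁ : platt_trudgian_numerical_rh)
    (h₂ : Polymath15.upper_bound_criterion) (h₃ : Polymath15.table1_row2) : platt_trudgian := by
  intro t ht
  refine h₂ 0.186 (5 * 10 ^ 12 + 194858) 0.16733 (by norm_num) (by norm_num) (by norm_num)
    (by norm_num) (Polymath15.initialZeroFree_of_platt_trudgian_numerical_rh h₁ (by norm_num)
      (by norm_num)) h₃.1 h₃.2 t ?_
  have h15 : (0.186 : ℝ) + 0.16733 ^ 2 / 2 < 1 / 5 := by norm_num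
  linarith

/-- `Λ ≤ 0.2` with the analytic input pushed down to Polymath 15, Prop. 3.3: from F1
(`platt_trudgian_numerical_rh`), Prop. 3.3 (`Polymath15.zero_free_region_criterion`) and F3
(`Polymath15.table1_row2`). [cite: PlattTrudgianBLMS2021, Cor. 2] -/
theorem platt_trudgian_of_zero_free_region_criterion (h₁ : platt_trudgian_numerical_rh)
    (h₂ : Polymath15.zero_free_region_criterion) (h₃ : Polymath15.table1_row2) : platt_trudgian :=
  platt_trudgian_of_polymath15 h₁
    (Polymath15.upper_bound_criterion_of_zero_free_region_criterion h₂) h₃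

/-- The `sInf` form `Λ ≤ 1/5` (`RH.deBruijnNewmanConst_le`) of Platt–Trudgian's Cor. 2 from the
three inputs (via `RH.deBruijnNewmanConst_le_of_platt_trudgian`, i.e. Newman's characterisation
`deBruijnNewmanConst_le_iff_holds` of `DeBruijnNewmanConstProofs.lean`).
[cite: PlattTrudgianBLMS2021, Cor. 2] -/
theorem deBruijnNewmanConst_le_of_polymath15 (h₁ : platt_trudgian_numerical_rh)
    (h₂ : Polymath15.upper_bound_criterion) (h₃ : Polymath15.table1_row2) :
    deBruijnNewmanConst_le :=
  deBruijnNewmanConst_le_of_platt_trudgian (platt_trudgian_of_polymath15 h₁ h₂ h₃)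

end RH

end Literature.NumberTheory.LFunctions

end
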